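import Literature.AlgebraicGeometry.Motives.SepQuotientGeometricPointOrbits
import HarnessLib

/-!
# Fibres of an INTERMEDIATE quotient on geometric points: `X → X/H → X/Δ` for a subgroup `H ≤ Δ` (not necessarily normal)

Topic `AlgebraicGeometry/Motives`; namespace `Literature.AlgebraicGeometry.Motives`.  PROOF FILE (theorems only: no definition, no
named fact, no instance, no `sorry`); sequel of ★ `Motives/SepQuotientGeometricPointOrbits.lean` (fibres of a separated quotient on
geometric points are single orbits; quotient maps are onto on geometric points).

Setting.  `k` a field, `X Y Z : SchemeOver k`, a finite group `Δ` acting on `X` by `k`-automorphisms `act : Δ →* Aut X`, a second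
finite group `Δ₁` mapped into `Δ` by `ι : Δ₁ →* Δ` (the typical case is the inclusion `H.subtype` of a subgroup `H ≤ Δ`, NOT assumed
normal), `p : X ⟶ Y` a quotient of `X` by `Δ` and `q : X ⟶ Z` a quotient of `X` by `Δ₁` (acting through `ι`), both for separated test
objects (`Motives.IsSepQuotient`), and `r : Z ⟶ Y` the intermediate map, `q ≫ r = p`.  For `τ : k →+* Ω` with `Ω` algebraically
closed we describe the fibres of `r` on `Ω`-points (SGA 1 V §1: `Y = X/Δ`, `Z = X/H`, `r : X/H → X/Δ`):

* §1 (pure category theory) `map_act_eq_of_isSepQuotient` (`p (g • P) = p P`), `map_comp_act_eq_of_comp_eq` (`r (q (g • P)) = p P`),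
  `map_hom_act_mul` (`(g * g′) • P = g • (g′ • P)` for the `Aut`-convention `(g * g′).hom = g′.hom ≫ g.hom`).
* §2 (geometric points; `X` projective over `k`, `Y`, `Z` separated)
  **`map_eq_map_iff_exists_eq_map_act`**: `r Q = p P ↔ ∃ g : Δ, Q = q (g • P)` — the `r`-fibre over `p P` is the `q`-IMAGE OF THE
  `Δ`-ORBIT of `P`; `setOf_map_eq_eq_range` (the same as an equality of sets); `surjective_map_geometric_of_comp_eq` (`r` is onto on
  `Ω`-points); **`map_act_eq_map_act_iff`**: `q (g • P) = q (g′ • P) ↔ ∃ h : Δ₁, (ι h * g) • P = g′ • P`.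
* §3 (free orbits) if the stabiliser of `P` in `Δ` is trivial: `q (g • P) = q (g′ • P) ↔ g′ * g⁻¹ ∈ ι.range`
  (`map_act_eq_map_act_iff_of_free`), and the `r`-fibre over `p P` has exactly `(Δ : ι.range)` geometric points
  (**`ncard_setOf_map_eq_eq_index_of_free`**) — the degree of `X/H → X/Δ` over a point with free orbit.

Everything is two applications of ★ `IsSepQuotient.exists_map_act_eq_of_map_eq_geometric` (to `p` and to `q`) and one of
★ `IsSepQuotient.surjective_map_geometric` (to `q`), plus group bookkeeping.

Use (cell `hodgecm-mathlib`, FLOOR 0, P5a, crux `HLiu418` = stmt-HodgeConjecture-24832, line `F0_D9opRoad2`; MOD-PLAN v0.5 §14 (1) row L6.4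
and PLAN-F0P5a v2 §2 row Γ3-Q): for a Shimura-curve tower `M_N → M_{K₁} → M_K` with `N ⊴ K` and `K₁ = K ∩ t K t⁻¹` (NOT normal in `K`),
the `\bar F_w`-point fibre of the level map `u′ : M_{K₁} → M_K` over `[x]_K` is the image in `M_{K₁}` of the `K/N`-orbit of `x`, with
`(K : K₁) = #(K t K / K)` points when the orbit is free — the reindexing behind the `α`-indexed Hecke sums of [Liu2021] Cor. D.9.  The
record instantiation is NOT in this file (generic capital only).  HC_CM is proved only modulo the 7 printed citations until rung 0 of the
ladder closes; this file is unconditional and citation-free in its hypotheses.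

## References
* [SGA1] A. Grothendieck, M. Raynaud, *SGA 1*, Exp. V §1, Prop. 1.1 (ii) (fibres of `X → X/G` on geometric points are orbits), Prop. 1.8,
  and §2 (the intermediate quotients `X/H`).
* [MumfordAV1970] D. Mumford, *Abelian Varieties* (1970), §7 Thm. p. 66 (1)–(3) and Remark.
* [Milne2005ShimuraVarieties] J. S. Milne, *Introduction to Shimura varieties* (2005), §5 p. 57 L7–12 («`Sh_K = Sh_{K′}/(K/K′)`»),
  §13 p. 118 L21–26 (Hecke correspondences via `K ∩ g K g⁻¹`).
-/

set_option autoImplicit false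

noncomputable section

open CategoryTheory AlgebraicGeometry

namespace Literature.AlgebraicGeometry.Motives

/-! ## §1 Pure bookkeeping (any field `L ⊇ k` of points, any index types) -/

section Pure

variable {k : Type} [Field k] {L : Type} [Field L] [Algebra k L] {Δ : Type} [Group Δ] {X Y Z : SchemeOver k}
  (act : Δ →* Aut X) {p : X ⟶ Y} {q : X ⟶ Z} {r : Z ⟶ Y}

/-- A separated quotient map is constant on orbits of `L`-points: `p (g • P) = p P`.  [cite: MumfordAV1970, §7 Thm. p. 66 (1)] -/
theorem map_act_eq_of_isSepQuotient (hp : IsSepQuotient (fun g => act g) p) (g : Δ) (P : AlgPoints X L) :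
    AlgPoints.map p (AlgPoints.map (act g).hom P) = AlgPoints.map p P := by
  rw [← AlgPoints.map_comp_apply, hp.hom_comp g]

/-- If `q ≫ r = p` with `p` a separated quotient by `Δ`, then `r (q (g • P)) = p P` for every `g : Δ` and every `L`-point `P`:
the `q`-image of the `Δ`-orbit of `P` lies in the `r`-fibre over `p P`.  [cite: SGA1, Exp. V §1 Prop. 1.1] -/
theorem map_comp_act_eq_of_comp_eq (hp : IsSepQuotient (fun g => act g) p) (hqr : q ≫ r = p) (g : Δ) (P : AlgPoints X L) :
    AlgPoints.map r (AlgPoints.map q (AlgPoints.map (act g).hom P)) = AlgPoints.map p P := by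
  rw [← AlgPoints.map_comp_apply q r, hqr, map_act_eq_of_isSepQuotient act hp]

/-- The action on points is a (left) action for Mathlib's `Aut`-convention `(g * g′).hom = g′.hom ≫ g.hom`:
`(g * g′) • P = g • (g′ • P)` — the finite group acts on the `L`-points (cf. ★ `Jacobian.map_act_mul`).  [cite: MumfordAV1970, §7 Thm. p. 66 (1)] -/
theorem map_hom_act_mul (g g' : Δ) (P : AlgPoints X L) :
    AlgPoints.map (act (g * g')).hom P = AlgPoints.map (act g).hom (AlgPoints.map (act g').hom P) := by
  rw [map_mul, Aut.Aut_mul_def, Iso.trans_hom, AlgPoints.map_comp_apply]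

/-- `1 • P = P` on `L`-points (cf. ★ `Jacobian.map_act_one`).  [cite: MumfordAV1970, §7 Thm. p. 66 (1)] -/
theorem map_hom_act_one (P : AlgPoints X L) : AlgPoints.map (act 1).hom P = P := by
  rw [map_one]
  exact AlgPoints.map_id_apply P

/-- `g⁻¹ • (g • P) = P` on `L`-points.  [cite: MumfordAV1970, §7 Thm. p. 66 (1)] -/
theorem map_hom_act_inv_map_hom_act (g : Δ) (P : AlgPoints X L) :
    AlgPoints.map (act g⁻¹).hom (AlgPoints.map (act g).hom P) = P := by
  rw [← map_hom_act_mul, inv_mul_cancel, map_hom_act_one]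

end Pure

/-! ## §2 Geometric points: the `r`-fibres are `q`-images of `Δ`-orbits -/

section Geometric

variable {k Ω : Type} [Field k] [Field Ω] [IsAlgClosed Ω] (τ : k →+* Ω) {Δ Δ₁ : Type} [Group Δ] [Fintype Δ] [Group Δ₁] [Fintype Δ₁]
  {X Y Z : SchemeOver k} (act : Δ →* Aut X) (ι : Δ₁ →* Δ) (p : X ⟶ Y) (q : X ⟶ Z) (r : Z ⟶ Y)

/-- **Fibres of the intermediate map on geometric points.**  `X` projective over `k`, `Y` and `Z` separated over `k`, `p : X ⟶ Y` a
quotient of `X` by the finite group `Δ` and `q : X ⟶ Z` a quotient of `X` by the finite group `Δ₁` acting through `ι : Δ₁ →* Δ` (e.g. a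
subgroup, not necessarily normal), both for separated test objects, `q ≫ r = p`, `τ : k → Ω` with `Ω` algebraically closed.  Then for
`Ω`-points `P` of `X` and `Q` of `Z`: `r Q = p P ↔ Q = q (g • P)` for some `g : Δ`.  Proof: `Q = q P′` (★ `q` onto on `Ω`-points), then
`p P′ = r Q = p P` forces `P′ = g • P` (★ fibres of `p` are orbits); conversely §1.
[cite: SGA1, Exp. V §1 Prop. 1.1 (ii) and §2] [cite: MumfordAV1970, §7 Thm. p. 66] -/
theorem map_eq_map_iff_exists_eq_map_act (hX : IsProjectiveOver X) (hY : IsSeparated Y.hom) (hZ : IsSeparated Z.hom)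
    (hp : IsSepQuotient (fun g => act g) p) (hq : IsSepQuotient (fun h => act (ι h)) q) (hqr : q ≫ r = p)
    (P : letI := τ.toAlgebra; AlgPoints X Ω) (Q : letI := τ.toAlgebra; AlgPoints Z Ω) :
    letI := τ.toAlgebra
    AlgPoints.map r Q = AlgPoints.map p P ↔ ∃ g : Δ, Q = AlgPoints.map q (AlgPoints.map (act g).hom P) := by
  letI := τ.toAlgebra
  refine ⟨fun h => ?_, ?_⟩
  · have hq' : IsSepQuotient (fun h => (act.comp ι) h) q := hq
    obtain ⟨P', rfl⟩ := IsSepQuotient.surjective_map_geometric τ (act.comp ι) q hX hZ hq' Q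
    have hPP' : AlgPoints.map p P = AlgPoints.map p P' := by
      rw [← h, ← AlgPoints.map_comp_apply, hqr]
    obtain ⟨g, hg⟩ := IsSepQuotient.exists_map_act_eq_of_map_eq_geometric τ act p hX hY hp hPP'
    exact ⟨g, by rw [hg]⟩
  · rintro ⟨g, rfl⟩
    exact map_comp_act_eq_of_comp_eq act hp hqr g P

/-- The `r`-fibre over `p P` on `Ω`-points, as a SET, is the `q`-image of the `Δ`-orbit of `P`.
[cite: SGA1, Exp. V §1 Prop. 1.1 (ii) and §2] -/
theorem setOf_map_eq_eq_range (hX : IsProjectiveOver X) (hY : IsSeparated Y.hom) (hZ : IsSeparated Z.hom)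
    (hp : IsSepQuotient (fun g => act g) p) (hq : IsSepQuotient (fun h => act (ι h)) q) (hqr : q ≫ r = p)
    (P : letI := τ.toAlgebra; AlgPoints X Ω) :
    letI := τ.toAlgebra
    {Q : AlgPoints Z Ω | AlgPoints.map r Q = AlgPoints.map p P}
      = Set.range (fun g : Δ => AlgPoints.map q (AlgPoints.map (act g).hom P)) := by
  letI := τ.toAlgebra
  ext Q
  rw [Set.mem_setOf_eq, map_eq_map_iff_exists_eq_map_act τ act ι p q r hX hY hZ hp hq hqr P Q, Set.mem_range]
  exact ⟨fun ⟨g, hg⟩ => ⟨g, hg.symm⟩, fun ⟨g, hg⟩ => ⟨g, hg.symm⟩⟩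

/-- The `r`-fibres on `Ω`-points are finite (at most `|Δ|` points).  [cite: SGA1, Exp. V §1 Prop. 1.1 (ii)] -/
theorem finite_setOf_map_eq (hX : IsProjectiveOver X) (hY : IsSeparated Y.hom) (hZ : IsSeparated Z.hom)
    (hp : IsSepQuotient (fun g => act g) p) (hq : IsSepQuotient (fun h => act (ι h)) q) (hqr : q ≫ r = p)
    (P : letI := τ.toAlgebra; AlgPoints X Ω) :
    letI := τ.toAlgebra
    {Q : AlgPoints Z Ω | AlgPoints.map r Q = AlgPoints.map p P}.Finite := by
  letI := τ.toAlgebra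
  rw [setOf_map_eq_eq_range τ act ι p q r hX hY hZ hp hq hqr P]
  exact Set.finite_range _

/-- The number of `Ω`-points in the `r`-fibre over `p P` is at most `|Δ|`.  [cite: SGA1, Exp. V §1 Prop. 1.1 (ii)] -/
theorem ncard_setOf_map_eq_le_card (hX : IsProjectiveOver X) (hY : IsSeparated Y.hom) (hZ : IsSeparated Z.hom)
    (hp : IsSepQuotient (fun g => act g) p) (hq : IsSepQuotient (fun h => act (ι h)) q) (hqr : q ≫ r = p)
    (P : letI := τ.toAlgebra; AlgPoints X Ω) :
    letI := τ.toAlgebra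
    {Q : AlgPoints Z Ω | AlgPoints.map r Q = AlgPoints.map p P}.ncard ≤ Fintype.card Δ := by
  letI := τ.toAlgebra
  classical
  rw [setOf_map_eq_eq_range τ act ι p q r hX hY hZ hp hq hqr P, ← Set.image_univ, ← Nat.card_eq_fintype_card, ← Set.ncard_univ Δ]
  exact Set.ncard_image_le Set.finite_univ

/-- **Every `Ω`-point of `Y` is `p` of something, hence the intermediate map `r` is onto on `Ω`-points** (`q ≫ r = p`, `p` a separated
quotient of the projective `X` by the finite group `Δ`).  [cite: SGA1, Exp. V §1 Prop. 1.1] -/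
theorem surjective_map_geometric_of_comp_eq (hX : IsProjectiveOver X) (hY : IsSeparated Y.hom)
    (hp : IsSepQuotient (fun g => act g) p) (hqr : q ≫ r = p) :
    letI := τ.toAlgebra; Function.Surjective (AlgPoints.map (L := Ω) r) := by
  letI := τ.toAlgebra
  intro Q'
  obtain ⟨P, hP⟩ := IsSepQuotient.surjective_map_geometric τ act p hX hY hp Q'
  exact ⟨AlgPoints.map q P, by rw [← AlgPoints.map_comp_apply, hqr, hP]⟩

omit [Fintype Δ] in
/-- **When do two orbit points have the same `q`-image?**  `q (g • P) = q (g′ • P) ↔ (ι h * g) • P = g′ • P` for some `h : Δ₁`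
(★ fibres of `q` are `Δ₁`-orbits, applied to `g • P`, `g′ • P`; `X` projective, `Z` separated).
[cite: SGA1, Exp. V §1 Prop. 1.1 (ii)] [cite: MumfordAV1970, §7 Thm. p. 66 (1)] -/
theorem map_act_eq_map_act_iff (hX : IsProjectiveOver X) (hZ : IsSeparated Z.hom) (hq : IsSepQuotient (fun h => act (ι h)) q)
    (P : letI := τ.toAlgebra; AlgPoints X Ω) (g g' : Δ) :
    letI := τ.toAlgebra
    AlgPoints.map q (AlgPoints.map (act g).hom P) = AlgPoints.map q (AlgPoints.map (act g').hom P)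
      ↔ ∃ h : Δ₁, AlgPoints.map (act (ι h * g)).hom P = AlgPoints.map (act g').hom P := by
  letI := τ.toAlgebra
  have hq' : IsSepQuotient (fun h => (act.comp ι) h) q := hq
  refine ⟨fun h => ?_, ?_⟩
  · obtain ⟨h₁, hh₁⟩ := IsSepQuotient.exists_map_act_eq_of_map_eq_geometric τ (act.comp ι) q hX hZ hq' h
    exact ⟨h₁, by rw [map_hom_act_mul]; exact hh₁⟩
  · rintro ⟨h₁, hh₁⟩
    rw [← hh₁, map_hom_act_mul]
    exact (map_act_eq_of_isSepQuotient (act.comp ι) hq' h₁ _).symm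

end Geometric

/-! ## §3 Free orbits: the fibre is a torsor under `ι.range \ Δ` and has `(Δ : ι.range)` points -/

section Free

variable {k Ω : Type} [Field k] [Field Ω] [IsAlgClosed Ω] (τ : k →+* Ω) {Δ Δ₁ : Type} [Group Δ] [Fintype Δ] [Group Δ₁] [Fintype Δ₁]
  {X Y Z : SchemeOver k} (act : Δ →* Aut X) (ι : Δ₁ →* Δ) (p : X ⟶ Y) (q : X ⟶ Z) (r : Z ⟶ Y)

omit [Fintype Δ] in
/-- **Free orbit**: if the stabiliser of the `Ω`-point `P` in `Δ` is trivial, then `q (g • P) = q (g′ • P) ↔ g′ * g⁻¹ ∈ ι.range`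
(i.e. `g`, `g′` lie in the same right coset of the image of `Δ₁`).  [cite: SGA1, Exp. V §1 Prop. 1.1 (ii) and §2] -/
theorem map_act_eq_map_act_iff_of_free (hX : IsProjectiveOver X) (hZ : IsSeparated Z.hom)
    (hq : IsSepQuotient (fun h => act (ι h)) q) (P : letI := τ.toAlgebra; AlgPoints X Ω)
    (hfree : letI := τ.toAlgebra; ∀ g : Δ, AlgPoints.map (act g).hom P = P → g = 1) (g g' : Δ) :
    letI := τ.toAlgebra
    AlgPoints.map q (AlgPoints.map (act g).hom P) = AlgPoints.map q (AlgPoints.map (act g').hom P) ↔ g' * g⁻¹ ∈ ι.range := by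
  letI := τ.toAlgebra
  rw [map_act_eq_map_act_iff τ act ι q hX hZ hq P g g', MonoidHom.mem_range]
  constructor
  · rintro ⟨h, hh⟩
    refine ⟨h, ?_⟩
    -- `(g′⁻¹ * (ι h * g)) • P = P`, so `g′⁻¹ * ι h * g = 1`
    have h1 : AlgPoints.map (act (g'⁻¹ * (ι h * g))).hom P = P := by
      rw [map_hom_act_mul, hh, map_hom_act_inv_map_hom_act]
    have h2 := hfree _ h1
    rw [inv_mul_eq_one] at h2
    rw [h2, mul_inv_cancel_right]
  · rintro ⟨h, hh⟩
    exact ⟨h, by rw [hh, inv_mul_cancel_right]⟩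

/-- **Free orbit, the count**: if the stabiliser of `P` in `Δ` is trivial, the `r`-fibre over `p P` has exactly `(Δ : ι.range)` points with
values in `Ω` — the degree of the intermediate quotient `X/H → X/Δ` read on a free geometric fibre.
[cite: SGA1, Exp. V §1 Prop. 1.1 (ii) and §2] [cite: Milne2005ShimuraVarieties, §5 p. 57 L7–12] -/
theorem ncard_setOf_map_eq_eq_index_of_free (hX : IsProjectiveOver X) (hY : IsSeparated Y.hom) (hZ : IsSeparated Z.hom)
    (hp : IsSepQuotient (fun g => act g) p) (hq : IsSepQuotient (fun h => act (ι h)) q) (hqr : q ≫ r = p)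
    (P : letI := τ.toAlgebra; AlgPoints X Ω)
    (hfree : letI := τ.toAlgebra; ∀ g : Δ, AlgPoints.map (act g).hom P = P → g = 1) :
    letI := τ.toAlgebra
    {Q : AlgPoints Z Ω | AlgPoints.map r Q = AlgPoints.map p P}.ncard = ι.range.index := by
  letI := τ.toAlgebra
  classical
  -- the fibre is the range of the orbit map `φ g = q (g • P)`, which factors through the right-coset space of `ι.range`
  -- as an injection
  set φ : Δ → AlgPoints Z Ω := fun g => AlgPoints.map q (AlgPoints.map (act g).hom P) with hφ
  have hker : ∀ g g' : Δ, φ g = φ g' ↔ QuotientGroup.rightRel ι.range g g' := fun g g' => by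
    rw [QuotientGroup.rightRel_apply]
    exact map_act_eq_map_act_iff_of_free τ act ι q hX hZ hq P hfree g g'
  let ψ : Quotient (QuotientGroup.rightRel ι.range) → AlgPoints Z Ω :=
    Quotient.lift φ fun g g' hgg' => (hker g g').2 hgg'
  have hψinj : Function.Injective ψ := by
    rintro ⟨g⟩ ⟨g'⟩ h
    exact Quotient.sound ((hker g g').1 h)
  have hrange : Set.range φ = Set.range ψ := by
    ext Q
    constructor
    · rintro ⟨g, rfl⟩
      exact ⟨Quotient.mk _ g, rfl⟩
    · rintro ⟨⟨g⟩, rfl⟩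
      exact ⟨g, rfl⟩
  rw [setOf_map_eq_eq_range τ act ι p q r hX hY hZ hp hq hqr P, ← hφ, hrange, Set.ncard_range_of_injective hψinj,
    Subgroup.index_eq_card, Nat.card_congr (QuotientGroup.quotientRightRelEquivQuotientLeftRel ι.range)]

end Free

/-! ## §4 (ed. 2) Finite-INDEX form: `Γ` any group acting through a finite quotient `Γ/N`

The towers of the cell deliver their quotient data for INFINITE groups acting through finitely many automorphisms: a compact open
`K` acts on `X_N` by the translates `k ↦ T_{k⁻¹}` (`↥K →* Aut X_N`), the open normal sub-level `N ⊴ K` of finite index acting trivially,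
and the intermediate level `K₁` (`N ≤ K₁ ≤ K`) acts by restriction.  This section restates §2 of ★ `SepQuotientGeometricPointOrbits` and
§2 above in that currency: `act : Γ →* Aut X` for ANY group `Γ`, a normal subgroup `N` of finite index with `act n = 1` for `n ∈ N`,
and a subgroup `Γ₁ ≤ Γ` acting through `act`; the finite groups `Γ/N`, `Γ₁/(N ∩ Γ₁)` and the induced `ι` are internal to the proofs.
-/

section FiniteIndex

variable {k Ω : Type} [Field k] [Field Ω] [IsAlgClosed Ω] (τ : k →+* Ω) {Γ : Type} [Group Γ]
  {X Y Z : SchemeOver k} (act : Γ →* Aut X) (Γ₁ N : Subgroup Γ) [N.Normal] [N.FiniteIndex]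
  (p : X ⟶ Y) (q : X ⟶ Z) (r : Z ⟶ Y)

/-- A separated quotient by `act : Γ →* Aut Y` is a separated quotient by the induced action of `Γ/N` when the normal subgroup `N`
acts trivially (the universal property only sees the set `{act g}`); cf. ★ `isSepQuotient_quotientLift` in
`Liu2021/AppendixC/HeckeTranslateLevelQuotient`, re-proved here to keep this generic file free of that import.
[cite: MumfordAV1970, §7 Thm. p. 66 (Remark)] -/
theorem IsSepQuotient.quotientGroup_lift {X' Y' : SchemeOver k} (N' : Subgroup Γ) [N'.Normal] (act' : Γ →* Aut X')
    (hN' : ∀ n ∈ N', act' n = 1) {p' : X' ⟶ Y'} (h : IsSepQuotient (fun g => act' g) p') :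
    IsSepQuotient (fun g => QuotientGroup.lift N' act' hN' g) p' := by
  refine ⟨fun g => ?_, fun W f hW hf => h.2 W f hW fun g => ?_⟩
  · induction g using QuotientGroup.induction_on with
    | H z => exact h.1 z
  · exact hf (g : Γ ⧸ N')

omit [N.FiniteIndex] in
/-- The restricted action of `Γ₁` through `act`, lifted to `Γ₁/(N ∩ Γ₁)`, is the `Γ/N`-action composed with the induced map
`ι : Γ₁/(N ∩ Γ₁) → Γ/N` (both are `act h` on representatives).  [cite: MumfordAV1970, §7 Thm. p. 66 (Remark)] -/
theorem quotientGroup_lift_map_subgroupOf (hN : ∀ n ∈ N, act n = 1) (h : ↥Γ₁ ⧸ N.subgroupOf Γ₁) :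
    QuotientGroup.lift N act hN (QuotientGroup.map (N.subgroupOf Γ₁) N Γ₁.subtype le_rfl h)
      = QuotientGroup.lift (N.subgroupOf Γ₁) (act.comp Γ₁.subtype)
          (fun n hn => hN (n : Γ) (Subgroup.mem_subgroupOf.1 hn)) h := by
  induction h using QuotientGroup.induction_on with
  | H z => rfl

/-- **Fibres of a separated quotient on geometric points are orbits — finite-INDEX form.**  `X` projective over `k`, `Y` separated,
`p : X ⟶ Y` a quotient for separated test objects by `act : Γ →* Aut X` where `Γ` is ANY group and some normal subgroup `N` of finite
index acts trivially; then `p P = p P′` on `Ω`-points forces `P′ = g • P` for some `g : Γ`.  (★ `IsSepQuotient.exists_map_act_eq_of_map_eq_geometric`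
for the finite group `Γ/N`.)  [cite: SGA1, Exp. V §1 Prop. 1.1 (ii)] [cite: MumfordAV1970, §7 Thm. p. 66 (1)] -/
theorem IsSepQuotient.exists_map_act_eq_of_map_eq_geometric_of_finiteIndex (hX : IsProjectiveOver X) (hY : IsSeparated Y.hom)
    (hN : ∀ n ∈ N, act n = 1) (hp : IsSepQuotient (fun g => act g) p)
    {P P' : letI := τ.toAlgebra; AlgPoints X Ω} (h : letI := τ.toAlgebra; AlgPoints.map p P = AlgPoints.map p P') :
    letI := τ.toAlgebra; ∃ g : Γ, AlgPoints.map (act g).hom P = P' := by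
  letI := τ.toAlgebra
  classical
  letI : Fintype (Γ ⧸ N) := Fintype.ofFinite _
  obtain ⟨g, hg⟩ := IsSepQuotient.exists_map_act_eq_of_map_eq_geometric τ (QuotientGroup.lift N act hN) p hX hY
    (IsSepQuotient.quotientGroup_lift N act hN hp) h
  induction g using QuotientGroup.induction_on with
  | H z => exact ⟨z, hg⟩

/-- **A separated quotient is onto on geometric points — finite-INDEX form** (same hypotheses).
[cite: SGA1, Exp. V §1 Prop. 1.1] -/
theorem IsSepQuotient.surjective_map_geometric_of_finiteIndex (hX : IsProjectiveOver X) (hY : IsSeparated Y.hom)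
    (hN : ∀ n ∈ N, act n = 1) (hp : IsSepQuotient (fun g => act g) p) :
    letI := τ.toAlgebra; Function.Surjective (AlgPoints.map (L := Ω) p) := by
  letI := τ.toAlgebra
  classical
  letI : Fintype (Γ ⧸ N) := Fintype.ofFinite _
  exact IsSepQuotient.surjective_map_geometric τ (QuotientGroup.lift N act hN) p hX hY
    (IsSepQuotient.quotientGroup_lift N act hN hp)

/-- **Fibres of the intermediate map on geometric points — finite-INDEX form.**  `X` projective over `k`, `Y`, `Z` separated,
`act : Γ →* Aut X` with `Γ` ANY group, `N ⊴ Γ` of finite index acting trivially, `Γ₁ ≤ Γ`, `p : X ⟶ Y` a separated quotient by `Γ`,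
`q : X ⟶ Z` a separated quotient by `Γ₁` (acting through `act`), `q ≫ r = p`: for `Ω`-points, `r Q = p P ↔ Q = q (g • P)` for some
`g : Γ`.  (§2 for the finite groups `Γ/N ⊇ Γ₁/(N ∩ Γ₁)`.)  [cite: SGA1, Exp. V §1 Prop. 1.1 (ii) and §2]
[cite: Milne2005ShimuraVarieties, §5 p. 57 L7–12] -/
theorem map_eq_map_iff_exists_eq_map_act_of_finiteIndex (hX : IsProjectiveOver X) (hY : IsSeparated Y.hom)
    (hZ : IsSeparated Z.hom) (hN : ∀ n ∈ N, act n = 1) (hp : IsSepQuotient (fun g => act g) p)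
    (hq : IsSepQuotient (fun h : Γ₁ => act h) q) (hqr : q ≫ r = p)
    (P : letI := τ.toAlgebra; AlgPoints X Ω) (Q : letI := τ.toAlgebra; AlgPoints Z Ω) :
    letI := τ.toAlgebra
    AlgPoints.map r Q = AlgPoints.map p P ↔ ∃ g : Γ, Q = AlgPoints.map q (AlgPoints.map (act g).hom P) := by
  letI := τ.toAlgebra
  classical
  letI : Fintype (Γ ⧸ N) := Fintype.ofFinite _
  letI : Fintype (↥Γ₁ ⧸ N.subgroupOf Γ₁) := Fintype.ofFinite _
  have hN₁ : ∀ n ∈ N.subgroupOf Γ₁, (act.comp Γ₁.subtype) n = 1 := fun n hn => hN (n : Γ) (Subgroup.mem_subgroupOf.1 hn)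
  have hq' : IsSepQuotient
      (fun h => QuotientGroup.lift N act hN (QuotientGroup.map (N.subgroupOf Γ₁) N Γ₁.subtype le_rfl h)) q := by
    have e : (fun h => QuotientGroup.lift N act hN (QuotientGroup.map (N.subgroupOf Γ₁) N Γ₁.subtype le_rfl h))
        = fun h => QuotientGroup.lift (N.subgroupOf Γ₁) (act.comp Γ₁.subtype) hN₁ h :=
      funext (quotientGroup_lift_map_subgroupOf act Γ₁ N hN)
    rw [e]
    exact IsSepQuotient.quotientGroup_lift (N.subgroupOf Γ₁) (act.comp Γ₁.subtype) hN₁ hq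
  rw [map_eq_map_iff_exists_eq_map_act τ (QuotientGroup.lift N act hN) (QuotientGroup.map (N.subgroupOf Γ₁) N Γ₁.subtype le_rfl)
    p q r hX hY hZ (IsSepQuotient.quotientGroup_lift N act hN hp) hq' hqr P Q]
  constructor
  · rintro ⟨g, hg⟩
    induction g using QuotientGroup.induction_on with
    | H z => exact ⟨z, hg⟩
  · rintro ⟨g, hg⟩
    exact ⟨(g : Γ ⧸ N), hg⟩

/-- **When do two orbit points have the same `q`-image — finite-INDEX form**: `q (g • P) = q (g′ • P) ↔ (h * g) • P = g′ • P` for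
some `h ∈ Γ₁` (`X` projective, `Z` separated, `q` a separated quotient by `Γ₁ ≤ Γ` acting through `act`, `N ⊴ Γ` of finite index
acting trivially).  [cite: SGA1, Exp. V §1 Prop. 1.1 (ii)] -/
theorem map_act_eq_map_act_iff_of_finiteIndex (hX : IsProjectiveOver X) (hZ : IsSeparated Z.hom) (hN : ∀ n ∈ N, act n = 1)
    (hq : IsSepQuotient (fun h : Γ₁ => act h) q) (P : letI := τ.toAlgebra; AlgPoints X Ω) (g g' : Γ) :
    letI := τ.toAlgebra
    AlgPoints.map q (AlgPoints.map (act g).hom P) = AlgPoints.map q (AlgPoints.map (act g').hom P)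
      ↔ ∃ h ∈ Γ₁, AlgPoints.map (act (h * g)).hom P = AlgPoints.map (act g').hom P := by
  letI := τ.toAlgebra
  classical
  letI : Fintype (Γ ⧸ N) := Fintype.ofFinite _
  letI : Fintype (↥Γ₁ ⧸ N.subgroupOf Γ₁) := Fintype.ofFinite _
  have hN₁ : ∀ n ∈ N.subgroupOf Γ₁, (act.comp Γ₁.subtype) n = 1 := fun n hn => hN (n : Γ) (Subgroup.mem_subgroupOf.1 hn)
  have hq' : IsSepQuotient
      (fun h => QuotientGroup.lift N act hN (QuotientGroup.map (N.subgroupOf Γ₁) N Γ₁.subtype le_rfl h)) q := by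
    have e : (fun h => QuotientGroup.lift N act hN (QuotientGroup.map (N.subgroupOf Γ₁) N Γ₁.subtype le_rfl h))
        = fun h => QuotientGroup.lift (N.subgroupOf Γ₁) (act.comp Γ₁.subtype) hN₁ h :=
      funext (quotientGroup_lift_map_subgroupOf act Γ₁ N hN)
    rw [e]
    exact IsSepQuotient.quotientGroup_lift (N.subgroupOf Γ₁) (act.comp Γ₁.subtype) hN₁ hq
  have key := map_act_eq_map_act_iff τ (QuotientGroup.lift N act hN) (QuotientGroup.map (N.subgroupOf Γ₁) N Γ₁.subtype le_rfl)
    q hX hZ hq' P (g : Γ ⧸ N) (g' : Γ ⧸ N)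
  -- `QuotientGroup.lift N act hN ↑g = act g` definitionally
  change AlgPoints.map q (AlgPoints.map (act g).hom P) = AlgPoints.map q (AlgPoints.map (act g').hom P) ↔ _ at key
  rw [key]
  constructor
  · rintro ⟨h, hh⟩
    induction h using QuotientGroup.induction_on with
    | H z => exact ⟨(z : Γ), z.2, hh⟩
  · rintro ⟨h, hmem, hh⟩
    exact ⟨((⟨h, hmem⟩ : Γ₁) : ↥Γ₁ ⧸ N.subgroupOf Γ₁), hh⟩

/-- **The intermediate map is onto on geometric points — finite-INDEX form** (`q ≫ r = p`, `p` a separated quotient of the projective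
`X` by `Γ` acting through a finite quotient).  [cite: SGA1, Exp. V §1 Prop. 1.1] -/
theorem surjective_map_geometric_of_comp_eq_of_finiteIndex (hX : IsProjectiveOver X) (hY : IsSeparated Y.hom)
    (hN : ∀ n ∈ N, act n = 1) (hp : IsSepQuotient (fun g => act g) p) (hqr : q ≫ r = p) :
    letI := τ.toAlgebra; Function.Surjective (AlgPoints.map (L := Ω) r) := by
  letI := τ.toAlgebra
  intro Q'
  obtain ⟨P, hP⟩ := IsSepQuotient.surjective_map_geometric_of_finiteIndex τ act N p hX hY hN hp Q'
  exact ⟨AlgPoints.map q P, by rw [← AlgPoints.map_comp_apply, hqr, hP]⟩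

end FiniteIndex

/-! ## §5 (ed. 3) Reindexing the family of automorphisms -/

section Reindex

variable {k : Type} [Field k] {Y Z : SchemeOver k} {Δ Δ' : Type} {act : Δ → (Y ≅ Y)} {act' : Δ' → (Y ≅ Y)} {p : Y ⟶ Z}

/-- **A separated quotient for one family of automorphisms is a separated quotient for any family with the same members**: if every
`act' d'` is some `act d` and every `act d` is some `act' d'`, then `IsSepQuotient act p → IsSepQuotient act' p` (the universal property
of [MumfordAV1970] §7 only sees the SET `{act g}`; used to identify the restriction of a group action to a subgroup with an
independently given action of that subgroup).  [cite: MumfordAV1970, §7 Thm. p. 66 (Remark)] -/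
theorem IsSepQuotient.of_forall_exists (h₁ : ∀ d', ∃ d, act' d' = act d) (h₂ : ∀ d, ∃ d', act d = act' d')
    (hp : IsSepQuotient act p) : IsSepQuotient act' p := by
  refine ⟨fun d' => ?_, fun W f hW hf => hp.2 W f hW fun d => ?_⟩
  · obtain ⟨d, hd⟩ := h₁ d'
    rw [hd]
    exact hp.1 d
  · obtain ⟨d', hd'⟩ := h₂ d
    rw [hd']
    exact hf d'

/-- Symmetric form: two families with the same members have the same separated quotients.  [cite: MumfordAV1970, §7 Thm. p. 66 (Remark)] -/
theorem IsSepQuotient.iff_of_forall_exists (h₁ : ∀ d', ∃ d, act' d' = act d) (h₂ : ∀ d, ∃ d', act d = act' d') :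
    IsSepQuotient act p ↔ IsSepQuotient act' p :=
  ⟨IsSepQuotient.of_forall_exists h₁ h₂, IsSepQuotient.of_forall_exists (fun d => (h₂ d).imp fun _ h => h)
    (fun d' => (h₁ d').imp fun _ h => h)⟩

end Reindex

end Literature.AlgebraicGeometry.Motives

end
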